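/-
Origin: expansion seat `planner-pub-hodgecm-pohl-g15-0`, handover #15 2026-08-18T16:19:39Z (md5 2524754d1cbbeb2284faf1a8e31d0ca2, 291 l.; RUN-32 CANDIDATE ROW, ON REQUEST ONLY — TREE-SHAPE SPLIT (≤400 l.) of the pohl lineage, source lines verbatim; REPLACES HodgeCM/Proofs/Pohlmann/GaloisSpanSexticClosure.lean in place (module name kept ⇒ no importer edits); lands AFTER GaloisSpanPairKernel; rewrites import Pohl15.GaloisSpanPairKernel -> HodgeCM.Proofs.Pohlmann.G (`HOME/pub-hodgecm-pohl-g15/lean/Pohl15/GaloisSpanSexticClosure.lean`, md5 2524754d, 291 lines);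
landed by the packager successor (mc-unitary-1-g3, gen-8 kit) in gate run 32 REPLACES the earlier landed copy of `HodgeCM/Proofs/Pohlmann/GaloisSpanSexticClosure.lean` (import ^import Pohl15\.GaloisSpanPairKernel[ \t]*$→import HodgeCM.Proofs.Pohlmann.GaloisSpanPairKernel ×1).
-/
/-
Copyright: pub-hodgecm formalisation cell (harness21, 2026). New file (not vendored).
Origin: HOME/pub-hodgecm-pohl-g15/lean/Pohl15/GaloisSpanSexticClosure.lean — session planner-pub-hodgecm-pohl-g15-0 (unit pub-hodgecm-pohl-g15),
EXPANSION part (b) `PohlmannSpan`, generation 15: TREE-SHAPE STAGING under the 400-line rule of lean/CONVENTIONS.md §2 — part 2/2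
of the split of `HodgeCM/Proofs/Pohlmann/GaloisSpanSexticClosure.lean` (pohl-g13 file 8, RUN 31 row d82eed87; 549 l., md5 d82eed87f499): source lines 325–549 VERBATIM; the module docstring below is the source's, with one `Layout` sentence appended.
Intended final place: `HodgeCM/Proofs/Pohlmann/GaloisSpanSexticClosure.lean` (module `HodgeCM.Proofs.Pohlmann.GaloisSpanSexticClosure`); WIP import `Pohl15.GaloisSpanPairKernel` → `HodgeCM.Proofs.Pohlmann.GaloisSpanPairKernel` on landing.  The LAST part keeps the old module name, so no importer changes.
-/
import Summits.HodgeConjecture.HodgeCM.Proofs.Pohlmann.GaloisSpanPairKernel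

/-!
# The pair kernel of `Gal(F̃/ℚ)`, `[F:ℚ] ∣ [F̃:ℚ]`, `F` Galois iff `[F̃:ℚ] = [F:ℚ]`, and SEXTIC CM fields:
# the naive Pohlmann span holds iff `[F̃:ℚ] ≠ 12`

`F` a CM field of degree `2g`, `F̃ = E^c` (`E = F¹`, `GaoUllmo.galoisClosure (Fin (0 + 1) → F)`) its Galois closure,
`G = Gal(F̃/ℚ)`.  File 7 coded `σ ∈ G` by (permutation of the `g` conjugate pairs, set of flipped pairs).  Here the first
coordinate is made a group homomorphism `pairPermHom Θ : G →* Perm(Θ)` (`Θ` any CM type `≃` the pairs), with kernel the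
PAIR KERNEL `K = pairKer Θ` = the elements mapping every pair `{t, t̄}` to itself (`galF_eq_self_or_conjugate_of_mem_pairKer`).

* `NonGalois.barAut_mem_pairKer` — `c ∈ K`; `NonGalois.mul_self_eq_one_of_mem_pairKer` — `K` has exponent `2`, so
  `NonGalois.exists_card_pairKer_eq_two_pow` — `|K| = 2^a`; `NonGalois.card_pairKer_le_two_pow` — `|K| ≤ 2^g`;
  `NonGalois.card_aut_dvd_card_pairKer_mul_factorial` — `|G| ∣ |K| · g!` (`G/K ↪ Perm(Θ) ≅ S_g`).
* `NonGalois.galF_eq_swap_of_mem_pairKer` — an element of `K` flipping EXACTLY ONE pair `{t₀, t̄₀}` acts on `Hom(F, ℂ)` as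
  the transposition `t₀ ↔ t̄₀`; `NonGalois.galF_barAut_mul_not_mem_iff` — `cκ` flips exactly the pairs `κ` does not;
  `NonGalois.exists_galF_eq_swap_of_mem_pairKer_of_card_eq_three` — for `g = 3`, ANY `κ ∈ K ∖ {1, c}` yields a single
  sign change (`κ` flips one or two of the three pairs; in the second case `cκ` flips one).
* The action of `G` on `Hom(F, ℂ)` as a (local) `MulAction` (`galFAction`; transitive by file 2): orbit–stabiliser
  `NonGalois.finrank_mul_card_stabilizer` — `[F:ℚ] · |Stab(s₀)| = |G|`; **`NonGalois.finrank_dvd_finrank_galoisClosure`** —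
  `[F:ℚ] ∣ [F̃:ℚ]` (any number field); `NonGalois.stabilizer_eq_bot_of_isGalois`;
  **`NonGalois.isGalois_iff_finrank_galoisClosure_eq`** — `F/ℚ` is Galois iff `[F̃:ℚ] = [F:ℚ]` (⇒: every embedding is
  `s₀ ∘ α` by counting, so `Stab(s₀)` acts trivially, and the action is faithful (file 4); ⇐: `s₀ : F ≃ F̃`).
* **`NonGalois.finrank_galoisClosure_eq_or_of_finrank_eq_six`** — for a SEXTIC CM field `[F̃:ℚ] ∈ {6, 12, 24, 48}`
  (`|G| = |K|·|G/K|`, `|K| = 2^a ≤ 8`, `|G/K| ∣ 6`, `6 ∣ |G|`).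
* **`NonGalois.exists_galF_eq_swap_of_finrank_eq_24`**, **`NonGalois.galSpanCondition_of_finrank_eq_24`** — a sextic CM
  field whose Galois closure has degree `24` admits a single sign change in `G` (`24 ∣ |K|·3!` forces `|K| ≥ 4 > |{1, c}|`),
  hence satisfies the Galois span condition `LIN(F)` at every level (file 4's sign-change criterion);
  `Universe.naivePohlmannSpanAt_of_finrank_galoisClosure_eq_24`.
* **`NonGalois.galSpanCondition_iff_finrank_galoisClosure_ne_twelve (h6 : finrank ℚ F = 6) (m) :
    GalSpanCondition F m ↔ finrank ℚ (galoisClosure (Fin (0 + 1) → F)) ≠ 12`** — the COMPLETE sextic classification: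
  `6` = Galois (file 1), `12` FAILS (file 5: then `F` is not Galois, `Aut(F/ℚ) = {1, c}`, closure `< 18`), `24` PASSES
  (this file), `48` PASSES (file 7, the generic case).
* **`Universe.forall_naivePohlmannSpanAt_iff_finrank_galoisClosure_ne_twelve`** — under the model axioms and N1–N3, a
  SEXTIC CM field satisfies the naive (old-index-set) Pohlmann span for every family of CM types at every level iff its
  Galois closure does not have degree `12`.
* `NonGalois.finrank_galoisClosure_eq_twelve_of_subfield` — with file 6: a NON-Galois sextic CM field containing a proper
  totally complex (= imaginary quadratic) subfield has Galois closure of degree exactly `12` (the converse — closure `12`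
  ⇒ such a subfield — is classical group theory in `C₂ × S₃` and is not formalised here).

Nothing is posited; nothing is cited.

Layout (2026-08-18, tree 400-line rule): `section PairKernel` (the pair kernel and its flip sets; former first half of this file) is now `GaloisSpanPairKernel.lean`, imported here; all statements verbatim.
-/

noncomputable section

open scoped TensorProduct NumberField BigOperators
open NumberField NumberField.ComplexEmbedding

attribute [local instance] Classical.propDecidable

namespace HodgeCM

open Literature.AlgebraicGeometry.Motives (CMType HodgeStructure)
open HodgeCM.Pohlmann HodgeCM.GaoUllmo HodgeCM.CMTypeOps

namespace NonGalois

/-! ### `Gal(F̃/ℚ)` acting on `Hom(F, ℂ)`: orbit–stabiliser, and the Galois closure detects `IsGalois` -/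

section GalAction

variable (F : Type) [Field F] [NumberField F]

/-- The action `σ • s = σ ∘ s` of `Gal(F̃/ℚ)` on `Hom(F, ℂ)` (`galF 0`), as a `MulAction` (used as a LOCAL instance only). -/
@[reducible] def galFAction : MulAction (galoisClosure (Fin (0 + 1) → F) ≃ₐ[ℚ] galoisClosure (Fin (0 + 1) → F)) (F →+* ℂ) where
  smul σ s := galF 0 σ s
  one_smul s := galF_one (n := 0) s
  mul_smul σ τ s := galF_mul σ τ s

attribute [local instance] galFAction

variable {F} in
/-- (Ported verbatim from the HodgeCMPerL package; no docstring in the source.) -/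
theorem galFAction_smul (σ : galoisClosure (Fin (0 + 1) → F) ≃ₐ[ℚ] galoisClosure (Fin (0 + 1) → F)) (s : F →+* ℂ) :
    σ • s = galF 0 σ s := rfl

/-- The action is transitive (`exists_galF_apply_eq`, file 2). -/
theorem isPretransitive_galFAction :
    MulAction.IsPretransitive (galoisClosure (Fin (0 + 1) → F) ≃ₐ[ℚ] galoisClosure (Fin (0 + 1) → F)) (F →+* ℂ) :=
  ⟨fun s s' => exists_galF_apply_eq s s'⟩

attribute [local instance] isPretransitive_galFAction

/-- **Orbit–stabiliser**: `[F:ℚ] · |Stab(s₀)| = |Gal(F̃/ℚ)|`. -/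
theorem finrank_mul_card_stabilizer (s₀ : F →+* ℂ) :
    Module.finrank ℚ F * Nat.card (MulAction.stabilizer (galoisClosure (Fin (0 + 1) → F) ≃ₐ[ℚ] galoisClosure (Fin (0 + 1) → F)) s₀) =
      Nat.card (galoisClosure (Fin (0 + 1) → F) ≃ₐ[ℚ] galoisClosure (Fin (0 + 1) → F)) := by
  have h := Subgroup.index_mul_card (MulAction.stabilizer (galoisClosure (Fin (0 + 1) → F) ≃ₐ[ℚ] galoisClosure (Fin (0 + 1) → F)) s₀)
  rw [MulAction.index_stabilizer_of_transitive, Nat.card_eq_fintype_card, NumberField.Embeddings.card] at h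
  exact h

/-- **`[F:ℚ]` divides `[F̃:ℚ]`.** -/
theorem finrank_dvd_finrank_galoisClosure : Module.finrank ℚ F ∣ Module.finrank ℚ (galoisClosure (Fin (0 + 1) → F)) := by
  obtain ⟨s₀⟩ : Nonempty (F →+* ℂ) := inferInstance
  rw [← IsGalois.card_aut_eq_finrank ℚ (galoisClosure (Fin (0 + 1) → F))]
  exact Dvd.intro _ (finrank_mul_card_stabilizer F s₀)

variable {F} in
/-- (Ported verbatim from the HodgeCMPerL package; no docstring in the source.) -/
theorem galF_comp_algEquiv (σ : galoisClosure (Fin (0 + 1) → F) ≃ₐ[ℚ] galoisClosure (Fin (0 + 1) → F)) (s : F →+* ℂ) (α : F ≃ₐ[ℚ] F) :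
    galF 0 σ (s.comp (α : F →+* F)) = (galF 0 σ s).comp (α : F →+* F) :=
  RingHom.ext fun _ => rfl

/-- For `F/ℚ` Galois every complex embedding is `s₀ ∘ α`, `α ∈ Aut(F/ℚ)` (counting: `#Aut = [F:ℚ] = #Hom(F, ℂ)`). -/
theorem exists_eq_comp_algEquiv_of_isGalois [IsGalois ℚ F] (s₀ s : F →+* ℂ) : ∃ α : F ≃ₐ[ℚ] F, s = s₀.comp (α : F →+* F) := by
  have hinj : Function.Injective (fun α : F ≃ₐ[ℚ] F => s₀.comp (α : F →+* F)) := by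
    intro α β h
    refine AlgEquiv.ext fun a => s₀.injective ?_
    exact RingHom.congr_fun h a
  have hc : Nat.card (F →+* ℂ) ≤ Nat.card (F ≃ₐ[ℚ] F) := by
    rw [IsGalois.card_aut_eq_finrank, Nat.card_eq_fintype_card, NumberField.Embeddings.card]
  obtain ⟨α, hα⟩ := (hinj.bijective_of_nat_card_le hc).2 s
  exact ⟨α, hα.symm⟩

/-- For `F/ℚ` Galois the stabiliser of `s₀` in `Gal(F̃/ℚ)` is trivial (it fixes every `s₀ ∘ α`, and the action is faithful). -/
theorem stabilizer_eq_bot_of_isGalois [IsGalois ℚ F] (s₀ : F →+* ℂ) :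
    MulAction.stabilizer (galoisClosure (Fin (0 + 1) → F) ≃ₐ[ℚ] galoisClosure (Fin (0 + 1) → F)) s₀ = ⊥ := by
  refine (Subgroup.eq_bot_iff_forall _).mpr fun σ hσ => ?_
  rw [MulAction.mem_stabilizer_iff, galFAction_smul] at hσ
  refine galF_eq_id_iff.mp (funext fun s => ?_)
  obtain ⟨α, rfl⟩ := exists_eq_comp_algEquiv_of_isGalois F s₀ s
  rw [id, galF_comp_algEquiv, hσ]

/-- **`F/ℚ` Galois ⇒ `[F̃:ℚ] = [F:ℚ]`.** -/
theorem finrank_galoisClosure_eq_of_isGalois [IsGalois ℚ F] :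
    Module.finrank ℚ (galoisClosure (Fin (0 + 1) → F)) = Module.finrank ℚ F := by
  obtain ⟨s₀⟩ : Nonempty (F →+* ℂ) := inferInstance
  have h := finrank_mul_card_stabilizer F s₀
  rw [stabilizer_eq_bot_of_isGalois, Subgroup.card_bot, mul_one, IsGalois.card_aut_eq_finrank] at h
  exact h.symm

/-- **`[F̃:ℚ] = [F:ℚ]` ⇒ `F/ℚ` Galois** (`s₀ : F → F̃` is then an isomorphism onto the Galois field `F̃`). -/
theorem isGalois_of_finrank_galoisClosure_eq (h : Module.finrank ℚ (galoisClosure (Fin (0 + 1) → F)) = Module.finrank ℚ F) :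
    IsGalois ℚ F := by
  obtain ⟨s₀⟩ : Nonempty (F →+* ℂ) := inferInstance
  let j : F →ₐ[ℚ] galoisClosure (Fin (0 + 1) → F) :=
    ((corestrict (Fin (0 + 1) → F) (piEmb 0 s₀) : (Fin (0 + 1) → F) →+* galoisClosure (Fin (0 + 1) → F)).comp
      piDiag).toRatAlgHom
  have hinj : Function.Injective j := j.toRingHom.injective
  have hsurj : Function.Surjective j :=
    (LinearMap.injective_iff_surjective_of_finrank_eq_finrank h.symm (f := j.toLinearMap)).mp hinj
  exact IsGalois.of_algEquiv (AlgEquiv.ofBijective j ⟨hinj, hsurj⟩).symm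

/-- `F/ℚ` is Galois iff its Galois closure (à la Gao–Ullmo, inside `ℂ`) has the same degree. -/
theorem isGalois_iff_finrank_galoisClosure_eq :
    IsGalois ℚ F ↔ Module.finrank ℚ (galoisClosure (Fin (0 + 1) → F)) = Module.finrank ℚ F :=
  ⟨fun _ => finrank_galoisClosure_eq_of_isGalois F, isGalois_of_finrank_galoisClosure_eq F⟩

end GalAction

/-! ### Sextic CM fields: the Galois closure has degree 6, 12, 24 or 48, and degree 24 PASSES -/

section Sextic

variable {F : Type} [Field F] [NumberField F] [IsCMField F]

/-- **`[F̃:ℚ] ∈ {6, 12, 24, 48}` for a sextic CM field** (`|G| = |K| · |G/K|` with `|K| = 2^a ≤ 2³`, `|G/K| ∣ 3!`, `6 ∣ |G|`). -/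
theorem finrank_galoisClosure_eq_or_of_finrank_eq_six (h6 : Module.finrank ℚ F = 6) :
    Module.finrank ℚ (galoisClosure (Fin (0 + 1) → F)) = 6 ∨ Module.finrank ℚ (galoisClosure (Fin (0 + 1) → F)) = 12 ∨
      Module.finrank ℚ (galoisClosure (Fin (0 + 1) → F)) = 24 ∨ Module.finrank ℚ (galoisClosure (Fin (0 + 1) → F)) = 48 := by
  have h1 : Nat.card (pairKer (placesType F)) * (pairKer (placesType F)).index =
      Nat.card (galoisClosure (Fin (0 + 1) → F) ≃ₐ[ℚ] galoisClosure (Fin (0 + 1) → F)) := Subgroup.card_mul_index _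
  have h2 : (pairKer (placesType F)).index = Nat.card (pairPermHom (placesType F)).range := Subgroup.index_ker _
  have h3 : Nat.card (pairPermHom (placesType F)).range ∣ Nat.card (Equiv.Perm ↥(placesType F).1) :=
    Subgroup.card_subgroup_dvd_card _
  rw [Nat.card_eq_fintype_card (α := Equiv.Perm ↥(placesType F).1), Fintype.card_perm, card_coe_type, h6] at h3
  have h4 := card_pairKer_le_two_pow (placesType F)
  obtain ⟨a, ha⟩ := exists_card_pairKer_eq_two_pow (placesType F)
  have h5 := finrank_dvd_finrank_galoisClosure F
  rw [h6, ha] at h4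
  rw [IsGalois.card_aut_eq_finrank, h2, ha] at h1
  rw [h6] at h5
  have ha3 : a ≤ 3 := by
    by_contra hlt
    have : 2 ^ 4 ≤ 2 ^ a := Nat.pow_le_pow_right (by norm_num) (by omega)
    have h16 : (2 : ℕ) ^ 4 = 16 := by norm_num
    have h8 : (2 : ℕ) ^ (6 / 2) = 8 := by norm_num
    omega
  have hpow : 2 ^ a = 1 ∨ 2 ^ a = 2 ∨ 2 ^ a = 4 ∨ 2 ^ a = 8 := by
    interval_cases a
    · exact Or.inl rfl
    · exact Or.inr (Or.inl rfl)
    · exact Or.inr (Or.inr (Or.inl rfl))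
    · exact Or.inr (Or.inr (Or.inr rfl))
  have hfac : (6 / 2 : ℕ).factorial = 6 := rfl
  rw [hfac] at h3
  obtain ⟨r, hr⟩ : ∃ r, Nat.card (pairPermHom (placesType F)).range = r := ⟨_, rfl⟩
  rw [hr] at h1 h3
  have hr6 : r ≤ 6 := Nat.le_of_dvd (by norm_num) h3
  rcases hpow with hp | hp | hp | hp <;> rw [hp] at h1 <;> interval_cases r <;> omega

/-- **Closure degree `24` ⇒ a single sign change.**  For a sextic CM field with `[F̃:ℚ] = 24`: `24 ∣ |K| · 3!` gives
`|K| ≥ 4 > |{1, c}|`, and an element of `K ∖ {1, c}` (or its product with `c`) flips exactly one of the three pairs. -/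
theorem exists_galF_eq_swap_of_finrank_eq_24 (h6 : Module.finrank ℚ F = 6)
    (h24 : Module.finrank ℚ (galoisClosure (Fin (0 + 1) → F)) = 24) :
    ∃ (σ : galoisClosure (Fin (0 + 1) → F) ≃ₐ[ℚ] galoisClosure (Fin (0 + 1) → F)) (t₀ : F →+* ℂ),
      galF 0 σ = Equiv.swap t₀ (conjugate t₀) := by
  have hdvd := card_aut_dvd_card_pairKer_mul_factorial (placesType F)
  rw [IsGalois.card_aut_eq_finrank, h24, h6] at hdvd
  have hK : 2 < Nat.card (pairKer (placesType F)) := by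
    have h0 : 0 < Nat.card (pairKer (placesType F)) := Nat.card_pos
    have : (6 / 2 : ℕ).factorial = 6 := rfl
    rw [this] at hdvd
    omega
  obtain ⟨κ, hκ, h1, hc⟩ := exists_mem_pairKer_ne_of_two_lt_card (placesType F) hK
  have h3 : Fintype.card ↥(placesType F).1 = 3 := by rw [card_coe_type, h6]
  exact exists_galF_eq_swap_of_mem_pairKer_of_card_eq_three (placesType F) h3 hκ h1 hc

/-- **Theorem (sextic, closure degree 24 PASSES).**  A sextic CM field whose Galois closure has degree `24` satisfies the
Galois span condition `LIN(F)` at every level. -/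
theorem galSpanCondition_of_finrank_eq_24 (h6 : Module.finrank ℚ F = 6)
    (h24 : Module.finrank ℚ (galoisClosure (Fin (0 + 1) → F)) = 24) (m : ℕ) : GalSpanCondition F m := by
  obtain ⟨σ, t₀, hσ⟩ := exists_galF_eq_swap_of_finrank_eq_24 h6 h24
  exact galSpanCondition_of_galF_eq_swap hσ m

/-- (Ported verbatim from the HodgeCMPerL package; no docstring in the source.) -/
theorem indexSetsAgree_of_finrank_eq_24 (h6 : Module.finrank ℚ F = 6)
    (h24 : Module.finrank ℚ (galoisClosure (Fin (0 + 1) → F)) = 24) {m : ℕ} (Θ : Fin (m + 1) → CMType F) (p : ℕ) :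
    IndexSetsAgree Θ p :=
  indexSetsAgree_of_galSpanCondition (galSpanCondition_of_finrank_eq_24 h6 h24 m) Θ p

/-- **THEOREM (sextic CM fields, complete classification).**  For a sextic CM field `F` the Galois span condition `LIN(F)`
holds (at any / every level) iff the Galois closure of `F` does NOT have degree `12` — i.e. iff
`[F̃:ℚ] ∈ {6 (Galois), 24, 48}`; degree `12` is exactly the case `Aut(F/ℚ) = {1, c}` with small closure of file 5. -/
theorem galSpanCondition_iff_finrank_galoisClosure_ne_twelve (h6 : Module.finrank ℚ F = 6) (m : ℕ) :
    GalSpanCondition F m ↔ Module.finrank ℚ (galoisClosure (Fin (0 + 1) → F)) ≠ 12 := by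
  constructor
  · intro h h12
    have hF : ¬ IsGalois ℚ F := by
      intro hG
      have h' := finrank_galoisClosure_eq_of_isGalois F
      omega
    exact not_galSpanCondition_of_finrank_eq_six h6 hF (by omega) m h
  · intro h
    rcases finrank_galoisClosure_eq_or_of_finrank_eq_six h6 with hd | hd | hd | hd
    · haveI : IsGalois ℚ F := isGalois_of_finrank_galoisClosure_eq F (hd.trans h6.symm)
      exact galSpanCondition_of_isGalois
    · exact absurd hd h
    · exact galSpanCondition_of_finrank_eq_24 h6 hd m
    · refine galSpanCondition_of_finrank_galoisClosure_eq ?_ m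
      rw [hd, h6]
      rfl

/-- With file 6: a non-Galois sextic CM field with a proper totally complex (imaginary quadratic) subfield `k ↪ F` has
Galois closure of degree exactly `12` (LIN fails by the subfield obstruction, and `12` is the only failing degree). -/
theorem finrank_galoisClosure_eq_twelve_of_subfield {k : Type} [Field k] [NumberField k] [IsTotallyComplex k]
    (h6 : Module.finrank ℚ F = 6) (hF : ¬ IsGalois ℚ F) (i : k →+* F) (hlt : Module.finrank ℚ k < Module.finrank ℚ F) :
    Module.finrank ℚ (galoisClosure (Fin (0 + 1) → F)) = 12 := by
  by_contra h
  exact not_galSpanCondition_of_subfield (autPair_of_finrank_eq_six h6 hF) i hlt 0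
    ((galSpanCondition_iff_finrank_galoisClosure_ne_twelve h6 0).mpr h)

end Sextic

end NonGalois

/-! ### Consequences for the naive Pohlmann span -/

namespace Universe

open NonGalois

variable {U : Universe}

/-- **Sextic CM fields with Galois closure of degree `24` satisfy the naive (old-index-set) Pohlmann span** for every
family of CM types at every level (such fields are never Galois). -/
theorem naivePohlmannSpanAt_of_finrank_galoisClosure_eq_24 (M : U.ModelAxioms) (hN1 : U.Fact_cupExterior)
    (hN2 : U.Fact_cup_hodge) (hN3 : U.Fact_pull_H0) (F : CMField) (h6 : Module.finrank ℚ (F : Type) = 6)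
    (h24 : Module.finrank ℚ (galoisClosure (Fin (0 + 1) → (F : Type))) = 24)
    {n : ℕ} (Θ : Fin (n + 1) → CMType F) (p : ℕ) : U.NaivePohlmannSpanAt F Θ p :=
  naivePohlmannSpanAt_of_galSpanCondition M hN1 hN2 hN3 (galSpanCondition_of_finrank_eq_24 h6 h24 n) Θ p

/-- **THEOREM (sextic CM fields and the naive Pohlmann span; model axioms + N1–N3).**  For a SEXTIC CM field `F`, the naive
(old-index-set) Pohlmann span holds for every family of CM types of `F` at every level iff the Galois closure of `F` does
not have degree `12` (`[F̃:ℚ] ∈ {6, 12, 24, 48}` always; `6` = `F` Galois = the tree's `PohlmannSpan` case). -/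
theorem forall_naivePohlmannSpanAt_iff_finrank_galoisClosure_ne_twelve (M : U.ModelAxioms) (hN1 : U.Fact_cupExterior)
    (hN2 : U.Fact_cup_hodge) (hN3 : U.Fact_pull_H0) (F : CMField) (h6 : Module.finrank ℚ (F : Type) = 6) :
    (∀ (n : ℕ) (Θ : Fin (n + 1) → CMType F) (p : ℕ), U.NaivePohlmannSpanAt F Θ p) ↔
      Module.finrank ℚ (galoisClosure (Fin (0 + 1) → (F : Type))) ≠ 12 := by
  rw [forall_naivePohlmannSpanAt_iff_galSpanCondition M hN1 hN2 hN3]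
  exact galSpanCondition_iff_finrank_galoisClosure_ne_twelve h6 0

end Universe

end HodgeCM
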